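import Summits.FinalStateConjecture.FinalStateConjecture.Theorems.PhotonSphereChannelsExteriorEnergyRW
import Summits.FinalStateConjecture.FinalStateConjecture.Theorems.PhotonSphereChannelsWindowedShellChannelsNearShoulder
import Summits.FinalStateConjecture.FinalStateConjecture.Theorems.PhotonSphereChannelsWindowedShellChannelsNearFarSplit

/-!
# Crux `WindowedShellChannels` (stmt-FinalStateConjecture-14085), line `Sketch` — stub `stub_nearHalfShare`
# (piece P2n of the per-mode line: the near-side, i.e. horizon-side, large-scale half-share)

For one mode `(s, ℓ)`, `s ≤ 2`, `s ≤ ℓ`, of the unit-mass Regge–Wheeler equation along the centred tortoise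
line `tortoiseRadius one_pos 0` and a time parity `σ` there are `c > 0`, `R₀ > 0`, `B₀ ≥ 0` such that every
finite-energy parity-`σ` solution whose Cauchy data are supported in `(−∞, −R₀)` radiates at least `c·E`
ahead of the forward cone of lag `B₀` about the photon sphere:
`c·E ≤ channelEnergy V 0 (−B₀) ψ atTop`.  Constants: `c = 1/4`, `R₀ = 9`, `B₀ = 0`, uniform in `(s, ℓ, σ)`.

Proof.  The landed TWO-ended near half `WindowedShellChannelsNear.stub_nearShoulder`
(file `…WindowedShellChannelsNearShoulder`: data supported in `(−∞, x_c − ρ)`, `ρ ≥ 9M` ⇒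
`(1/2)·E ≤ ch⁺(a) + ch⁻(a)` at the positive aperture `a = M/3 + 2M log(3/2)`, infinite energy allowed)
at `M = 1`, `x_c = 0`, `ρ = 9`.  For a parity-pure solution (`ψ(−t, ·) = σψ(t, ·)`; then `σ² = 1` or
`ψ ≡ 0`) the energy density is even in time, so `ch⁻(a) = ch⁺(a)` (sub-namespace `NearHalfShare`), whence
`(1/4)·E ≤ ch⁺(a) ≤ ch⁺(−0)` by the aperture monotonicity of channel energies
(`WindowedShellChannelsSplit.channelEnergy_mono_aperture`, file `…WindowedShellChannelsNearFarSplit`).  No definitions.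
[folklore]
-/

noncomputable section

set_option linter.dupNamespace false

namespace Summit.FinalStateConjecture.FinalStateConjecture.Theorems.WindowedShellChannelsSketch

open Literature.Geometry.Lorentzian Literature.Geometry.Lorentzian.ReggeWheeler Filter Set MeasureTheory
open scoped ENNReal Topology

namespace NearHalfShare

variable {V : ℝ → ℝ} {ψ : ℝ → ℝ → ℝ} {σ : ℝ}

/-- A parity-`σ` function of time with `σ² ≠ 1` vanishes identically. [folklore] -/
theorem eq_zero_of_parity (hpar : ∀ t x, ψ (-t) x = σ * ψ t x) (hσ : σ ^ 2 ≠ 1) (t x : ℝ) :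
    ψ t x = 0 := by
  have h1 := hpar (-t) x
  rw [neg_neg, hpar t x, ← mul_assoc] at h1
  have h2 : (1 - σ ^ 2) * ψ t x = 0 := by linear_combination h1
  exact (mul_eq_zero.1 h2).resolve_left (sub_ne_zero.2 (Ne.symm hσ))

/-- A parity-`σ` function with `σ² ≠ 1` is time-symmetric (it vanishes). [folklore] -/
theorem even_of_parity (hpar : ∀ t x, ψ (-t) x = σ * ψ t x) (hσ : σ ^ 2 ≠ 1) (t x : ℝ) :
    ψ (-t) x = 1 * ψ t x := by
  rw [eq_zero_of_parity hpar hσ (-t) x, eq_zero_of_parity hpar hσ t x, mul_zero]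

/-- **Time reflection.** For a parity-`σ` function with `σ² = 1` the energy density is even in
time: `e[ψ](−t, x) = e[ψ](t, x)`. [folklore] -/
theorem energyDensity_neg (hpar : ∀ t x, ψ (-t) x = σ * ψ t x) (hσ : σ ^ 2 = 1) (t x : ℝ) :
    energyDensity V ψ (-t) x = energyDensity V ψ t x := by
  unfold energyDensity
  have hfun : (fun τ => ψ τ x) = fun τ => σ * ψ (-τ) x := by
    funext τ
    have h := hpar (-τ) x
    rw [neg_neg] at h
    exact h
  have hd : deriv (fun τ => ψ τ x) (-t) = -(σ * deriv (fun τ => ψ τ x) t) := by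
    conv_lhs => rw [hfun]
    rw [deriv_const_mul_field, deriv_comp_neg (fun τ => ψ τ x) (-t), neg_neg]
    ring
  have h0 : ψ (-t) = fun y => σ * ψ t y := funext fun y => hpar t y
  have hx : deriv (ψ (-t)) x = σ * deriv (ψ t) x := by
    rw [h0, deriv_const_mul_field]
  rw [hd, hx, hpar t x]
  have e1 : (-(σ * deriv (fun τ => ψ τ x) t)) ^ 2 = σ ^ 2 * deriv (fun τ => ψ τ x) t ^ 2 := by ring
  have e2 : (σ * deriv (ψ t) x) ^ 2 = σ ^ 2 * deriv (ψ t) x ^ 2 := by ring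
  have e3 : (σ * ψ t x) ^ 2 = σ ^ 2 * ψ t x ^ 2 := by ring
  rw [e1, e2, e3, hσ, one_mul, one_mul, one_mul]

/-- For a parity-`σ` function with `σ² = 1` the exterior energies (any centre, any aperture) are even
in time. [folklore] -/
theorem exteriorEnergy_neg (hpar : ∀ t x, ψ (-t) x = σ * ψ t x) (hσ : σ ^ 2 = 1) (xc a t : ℝ) :
    exteriorEnergy V xc a ψ (-t) = exteriorEnergy V xc a ψ t := by
  unfold exteriorEnergy
  rw [abs_neg]
  exact lintegral_congr fun x => by rw [energyDensity_neg hpar hσ]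

/-- For a parity-`σ` function with `σ² = 1` the backward channel energy equals the forward one
(any centre, any aperture). [folklore] -/
theorem channelEnergy_atBot_eq_atTop (hpar : ∀ t x, ψ (-t) x = σ * ψ t x) (hσ : σ ^ 2 = 1)
    (xc a : ℝ) : channelEnergy V xc a ψ atBot = channelEnergy V xc a ψ atTop := by
  unfold channelEnergy
  have hcomp : exteriorEnergy V xc a ψ = (exteriorEnergy V xc a ψ) ∘ Neg.neg := by
    funext t
    simp only [Function.comp_apply]
    rw [exteriorEnergy_neg hpar hσ]
  conv_lhs => rw [hcomp]
  rw [Filter.liminf_comp, Filter.map_neg_atBot]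

/-- The same for every parity `σ` (for `σ² ≠ 1` the function vanishes). [folklore] -/
theorem channelEnergy_atBot_eq_atTop' (hpar : ∀ t x, ψ (-t) x = σ * ψ t x) (xc a : ℝ) :
    channelEnergy V xc a ψ atBot = channelEnergy V xc a ψ atTop := by
  by_cases hσ : σ ^ 2 = 1
  · exact channelEnergy_atBot_eq_atTop hpar hσ xc a
  · exact channelEnergy_atBot_eq_atTop (even_of_parity hpar hσ) (by norm_num) xc a

/-- Halving a two-sided bound in `ℝ≥0∞`: `c·E ≤ X + X ⇒ (c/2)·E ≤ X`. [folklore] -/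
theorem half_of_two_sided {c : ℝ} {E X : ℝ≥0∞} (h : ENNReal.ofReal c * E ≤ X + X) :
    ENNReal.ofReal (c / 2) * E ≤ X := by
  have h2 : ENNReal.ofReal c = 2 * ENNReal.ofReal (c / 2) := by
    rw [show (2 : ℝ≥0∞) = ENNReal.ofReal 2 by simp, ← ENNReal.ofReal_mul (by norm_num)]
    congr 1
    ring
  rw [h2, mul_assoc, ← two_mul] at h
  exact (ENNReal.mul_le_mul_iff_right (by norm_num) (by simp)).1 h

end NearHalfShare

open NearHalfShare in
/-- **Stub `stub_nearHalfShare` (piece P2n of the per-mode line of `Sketch`): the near-side large-scale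
half-share.**  For one mode `s ≤ 2`, `s ≤ ℓ` and a time parity `σ` there are `c > 0`, `R₀ > 0`, `B₀ ≥ 0`
(namely `c = 1/4`, `R₀ = 9`, `B₀ = 0`) such that every finite-energy parity-`σ` unit-mass Regge–Wheeler
solution along the centred tortoise line whose Cauchy data are supported in `(−∞, −R₀)` satisfies
`c·E ≤ channelEnergy V 0 (−B₀) ψ atTop`.  (Two-ended shoulder inequality `stub_nearShoulder` + time
reflection for parity-pure solutions + aperture monotonicity.) [folklore in method; new] -/
theorem stub_nearHalfShare (σ : ℝ) (s ℓ : ℕ) (hs : s ≤ 2) (hsℓ : s ≤ ℓ) : ∃ c : ℝ, 0 < c ∧ ∃ R₀ : ℝ, 0 < R₀ ∧ ∃ B₀ : ℝ, 0 ≤ B₀ ∧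
    ∀ ψ : ℝ → ℝ → ℝ, IsRWSolution 1 s ℓ (tortoiseRadius one_pos 0) ψ → (∀ t x, ψ (-t) x = σ * ψ t x) →
      CauchyDataSupportedOn ψ (Iio (-R₀)) → totalEnergy (linePotential 1 s ℓ (tortoiseRadius one_pos 0)) ψ 0 ≠ ⊤ →
        ENNReal.ofReal c * totalEnergy (linePotential 1 s ℓ (tortoiseRadius one_pos 0)) ψ 0 ≤
          channelEnergy (linePotential 1 s ℓ (tortoiseRadius one_pos 0)) 0 (-B₀) ψ atTop := by
  refine ⟨1 / 4, by norm_num, 9, by norm_num, 0, le_rfl, ?_⟩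
  intro ψ hψ hpar hsupp _
  have hr := isTortoiseRadius_tortoiseRadius one_pos (0 : ℝ)
  have hsupp' : CauchyDataSupportedOn ψ (Iio (0 - 9)) := by
    rw [zero_sub]
    exact hsupp
  have key := WindowedShellChannelsNear.stub_nearShoulder 1 one_pos 9 (by norm_num)
    (tortoiseRadius one_pos 0) 0 hr s ℓ hs hsℓ ψ hψ hsupp'
  rw [channelEnergy_atBot_eq_atTop' hpar] at key
  have hhalf := half_of_two_sided key
  rw [show (1 / 2 / 2 : ℝ) = 1 / 4 by norm_num] at hhalf
  refine hhalf.trans (WindowedShellChannelsSplit.channelEnergy_mono_aperture _ 0 ?_ ψ atTop)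
  rw [neg_zero]
  have hlog : 0 ≤ Real.log (3 / 2) := Real.log_nonneg (by norm_num)
  positivity

end Summit.FinalStateConjecture.FinalStateConjecture.Theorems.WindowedShellChannelsSketch

end
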